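import Summits.ValiantsHypothesis.ValiantsHypothesis.Theorems.DefinabilityGapLexCertificate
import Summits.ValiantsHypothesis.ValiantsHypothesis.Theorems.DefinabilityGapSymmetry
import HarnessLib

/-!
# Definability gap — the bottom-cell (echelon) certificate for the planted Kabanets–Impagliazzo generator

Kernel rung for `Theses.DefinabilityGap` item K1 (`KIPlantedHitting`, b = 1 clause), extending
`Theorems.DefinabilityGapLexCertificate`.

That file proves: if, for an injective ranking `π` of the seed cells, the lex-leading ("greedy") diagonals
`d_c^π` (`c ∈ T`) are `ℚ`-linearly independent, then the block permanents `(P_c)_{c ∈ T}` of the planted generator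
are algebraically independent (`kiPer_algebraicIndependent_of_linearIndependent`), and it certifies linear
independence by PRIVATE TOP CELLS (`linearIndependent_leadVecR_of_topCells`), which is equivalent to 2-peelability of
the cell hypergraph and therefore fails on every 2-core (e.g. the union of two translation classes of parabolas).

This file adds two strictly more general, purely combinatorial certificates:

* `linearIndependent_of_triangular` — the generic triangular criterion: vectors `v_i` with witnesses `w_i`,
  `v_i(w_i) ≠ 0`, and `v_i(w_j) = 0` whenever `r i < r j` for an injective rank `r`, are linearly independent;
* `linearIndependent_of_injective_max` — the ECHELON form: if every `v_i` has a largest nonzero coordinate `bot i`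
  and `i ↦ bot i` is injective, the family is linearly independent;

and the resulting kernel statements for the generator:

* `kiPer_algebraicIndependent_of_bottomInjective` — if the BOTTOM cells (the `π`-least-significant cells of the
  greedy diagonals `d_c^π`) are pairwise distinct on `T`, then `(P_c)_{c ∈ T}` is algebraically independent;
* `kiPer_algebraicIndependent_of_maxInjOn` — the same with the canonical bottom `(d_c^π).support.max`;
* `kiPer_hits_size_of_bottomCertificate` — hence every nonzero `D` with `2·complexity D + 1 ≤ g` is hit as soon as
  every `T` with `|T| ≤ g` admits a ranking with distinct bottoms.

Unlike top cells (the globally top-ranked cell lies on the diagonal of EVERY curve through it, so distinct tops are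
impossible on a 2-core), bottoms can be distinct on 2-cores: the instrument of the lens node (decomp-valiant lens 5,
g6, `instrument-bottom.md`) finds distinct-bottom rankings for every tested family with `|T| = 2q+1` at
`m = 3,4,5` (class pairs, pencils, bundles, random), where no peeling/top-cell certificate exists.

All statements are sorry-free and use only standard axioms.
-/

noncomputable section

open MvPolynomial
open Summit.ValiantsHypothesis.ValiantsHypothesis.Theorems.DefinabilityGapAffineRung
open Summit.ValiantsHypothesis.ValiantsHypothesis.Theorems.DefinabilityGapLexCertificate

namespace Summit.ValiantsHypothesis.ValiantsHypothesis.Theorems.DefinabilityGapBottomCertificate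

/-! ## 1. Generic certificates for linear independence of coordinate vectors -/

section Generic

variable {ι σ α K : Type*} [LinearOrder σ] [Field K]

/-- **Triangular criterion.** If each `v_i` has a witness coordinate `w_i` with `v_i(w_i) ≠ 0`, and `v_i` vanishes
at the witness of every `j` of strictly larger (injective) rank, then `(v_i)` is linearly independent. [folklore] -/
theorem linearIndependent_of_triangular (v : ι → α → K) (r : ι → σ) (w : ι → α)
    (hr : Function.Injective r) (hw : ∀ i, v i (w i) ≠ 0)
    (htri : ∀ i j, r i < r j → v i (w j) = 0) : LinearIndependent K v := by
  classical
  rw [linearIndependent_iff']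
  intro s g hs i hi
  by_contra hgi
  obtain ⟨i₀, hi₀, hmax⟩ :=
    Finset.exists_max_image (s.filter fun j => g j ≠ 0) r ⟨i, Finset.mem_filter.2 ⟨hi, hgi⟩⟩
  obtain ⟨hi₀s, hg₀⟩ := Finset.mem_filter.1 hi₀
  have h := congr_fun hs (w i₀)
  rw [Finset.sum_apply, Pi.zero_apply, Finset.sum_eq_single i₀] at h
  · rw [Pi.smul_apply, smul_eq_mul] at h
    exact hg₀ ((mul_eq_zero.1 h).resolve_right (hw i₀))
  · intro j hj hne
    rw [Pi.smul_apply, smul_eq_mul]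
    by_cases hgj : g j = 0
    · rw [hgj, zero_mul]
    · have hle : r j ≤ r i₀ := hmax j (Finset.mem_filter.2 ⟨hj, hgj⟩)
      rw [htri j i₀ (lt_of_le_of_ne hle fun h' => hne (hr h')), mul_zero]
  · exact fun h' => absurd hi₀s h'

/-- **Echelon criterion.** If every `v_i` has a largest nonzero coordinate `bot i` (w.r.t. a linear order on the
coordinates) and `i ↦ bot i` is injective, then `(v_i)` is linearly independent. [folklore] -/
theorem linearIndependent_of_injective_max (v : ι → σ → K) (bot : ι → σ) (hinj : Function.Injective bot)
    (hbot : ∀ i, v i (bot i) ≠ 0) (hmax : ∀ i x, v i x ≠ 0 → x ≤ bot i) : LinearIndependent K v :=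
  linearIndependent_of_triangular v bot bot hinj hbot fun i j hij => by
    by_contra h
    exact not_lt.2 (hmax i _ h) hij

/-- **Echelon criterion, dual form** (smallest nonzero coordinates pairwise distinct). [folklore] -/
theorem linearIndependent_of_injective_min (v : ι → σ → K) (top : ι → σ) (hinj : Function.Injective top)
    (htop : ∀ i, v i (top i) ≠ 0) (hmin : ∀ i x, v i x ≠ 0 → top i ≤ x) : LinearIndependent K v :=
  linearIndependent_of_triangular v (OrderDual.toDual ∘ top) top
    (OrderDual.toDual.injective.comp hinj) htop fun i j hij => by
    by_contra h
    exact not_lt.2 (hmin i _ h) (OrderDual.toDual_lt_toDual.1 hij)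

end Generic

/-! ## 2. The bottom-cell certificate for the planted generator -/

variable {τ : Type*} [LinearOrder τ] [WellFoundedGT τ]

/-- The greedy diagonal `d_c^π` has exactly `m` cells. [this file] -/
theorem card_support_leadExpR (m : ℕ) {π : (Fin (qOf m) × Fin (qOf m)) → τ} (hπ : Function.Injective π)
    (c : Fin 3 → Fin (qOf m)) : (leadExpR m π c).support.card = m := by
  classical
  obtain ⟨ρ, h⟩ := exists_leadExpR_eq m hπ c
  rw [h, Finsupp.mapDomain_support_of_injective (hπ.comp (cellEmb m c).injective),
    Finset.card_image_of_injective _ (hπ.comp (cellEmb m c).injective), card_support_permMonomial,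
    Fintype.card_fin]

/-- For `0 < m` the greedy diagonal is nonempty. [this file] -/
theorem support_leadExpR_nonempty (m : ℕ) (hm : 0 < m) {π : (Fin (qOf m) × Fin (qOf m)) → τ}
    (hπ : Function.Injective π) (c : Fin 3 → Fin (qOf m)) : (leadExpR m π c).support.Nonempty := by
  rw [← Finset.card_pos, card_support_leadExpR m hπ c]
  exact hm

omit [WellFoundedGT τ] in
/-- `leadVecR` is nonzero exactly on the support of `leadExpR`. [this file] -/
theorem leadVecR_ne_zero_iff (m : ℕ) (π : (Fin (qOf m) × Fin (qOf m)) → τ) (c : Fin 3 → Fin (qOf m)) (x : τ)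
    [WellFoundedGT τ] : leadVecR m π c x ≠ 0 ↔ x ∈ (leadExpR m π c).support := by
  rw [Finsupp.mem_support_iff, leadVecR, Nat.cast_ne_zero]

/-- **Bottom-cell certificate ⟹ algebraic independence (kernel).** Let `π` be an injective ranking of the seed cells
and `bot c` (`c ∈ T`) the `π`-least-significant cell of the greedy diagonal `d_c^π` (any cell of `d_c^π` below all
its other cells). If `c ↦ bot c` is injective on `T`, the block permanents `(P_c)_{c ∈ T}` of the planted generator
are algebraically independent over `ℂ`. Strictly extends the peeling / private-top-cell rung
(`kiPer_algebraicIndependent_of_topCells`): bottoms can be distinct on 2-cores of the cell hypergraph. [this file] -/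
theorem kiPer_algebraicIndependent_of_bottomInjective (m : ℕ) {π : (Fin (qOf m) × Fin (qOf m)) → τ}
    (hπ : Function.Injective π) (T : Finset (Fin 3 → Fin (qOf m))) (bot : T → τ)
    (hbot : ∀ c : T, bot c ∈ (leadExpR m π (c : Fin 3 → Fin (qOf m))).support)
    (hmax : ∀ c : T, ∀ x ∈ (leadExpR m π (c : Fin 3 → Fin (qOf m))).support, x ≤ bot c)
    (hinj : Function.Injective bot) :
    AlgebraicIndependent ℂ (fun c : T => kiPer m (c : Fin 3 → Fin (qOf m))) :=
  kiPer_algebraicIndependent_of_linearIndependent m hπ T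
    (linearIndependent_of_injective_max _ bot hinj
      (fun c => (leadVecR_ne_zero_iff m π c (bot c)).2 (hbot c))
      (fun c x hx => hmax c x ((leadVecR_ne_zero_iff m π c x).1 hx)))

/-- **Top-of-diagonal certificate** (dual form: the `π`-most-significant cells of the diagonals pairwise distinct).
Note: the most significant cell of `d_c^π` is the most significant cell of the whole block `S_c`, so on a 2-core of
the cell hypergraph this hypothesis cannot hold; it is recorded for completeness. [this file] -/
theorem kiPer_algebraicIndependent_of_topInjective (m : ℕ) {π : (Fin (qOf m) × Fin (qOf m)) → τ}
    (hπ : Function.Injective π) (T : Finset (Fin 3 → Fin (qOf m))) (top : T → τ)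
    (htop : ∀ c : T, top c ∈ (leadExpR m π (c : Fin 3 → Fin (qOf m))).support)
    (hmin : ∀ c : T, ∀ x ∈ (leadExpR m π (c : Fin 3 → Fin (qOf m))).support, top c ≤ x)
    (hinj : Function.Injective top) :
    AlgebraicIndependent ℂ (fun c : T => kiPer m (c : Fin 3 → Fin (qOf m))) :=
  kiPer_algebraicIndependent_of_linearIndependent m hπ T
    (linearIndependent_of_injective_min _ top hinj
      (fun c => (leadVecR_ne_zero_iff m π c (top c)).2 (htop c))
      (fun c x hx => hmin c x ((leadVecR_ne_zero_iff m π c x).1 hx)))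

/-- **General witness certificate.** An injective rank `r` on `T` and witness cells `w c ∈ d_c^π` such that `d_c^π`
avoids `w c'` whenever `r c < r c'` certify algebraic independence (covers peeling, bottom cells, and mixed
certificates). [this file] -/
theorem kiPer_algebraicIndependent_of_witness (m : ℕ) {π : (Fin (qOf m) × Fin (qOf m)) → τ}
    (hπ : Function.Injective π) (T : Finset (Fin 3 → Fin (qOf m))) {σ : Type*} [LinearOrder σ]
    (r : T → σ) (hr : Function.Injective r) (w : T → τ)
    (hw : ∀ c : T, w c ∈ (leadExpR m π (c : Fin 3 → Fin (qOf m))).support)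
    (htri : ∀ c c' : T, r c < r c' → w c' ∉ (leadExpR m π (c : Fin 3 → Fin (qOf m))).support) :
    AlgebraicIndependent ℂ (fun c : T => kiPer m (c : Fin 3 → Fin (qOf m))) :=
  kiPer_algebraicIndependent_of_linearIndependent m hπ T
    (linearIndependent_of_triangular _ r w hr
      (fun c => (leadVecR_ne_zero_iff m π c (w c)).2 (hw c))
      (fun c c' h => by
        by_contra hne
        exact htri c c' h ((leadVecR_ne_zero_iff m π c (w c')).1 hne)))

/-- **Canonical form.** With `bot c := (d_c^π).support.max` (in `WithBot τ`): if `0 < m` and `c ↦ bot c` is injective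
on `T`, then `(P_c)_{c ∈ T}` is algebraically independent. (`0 < m` is needed: for `m = 0` every `P_c = 1`.)
[this file] -/
theorem kiPer_algebraicIndependent_of_maxInjOn (m : ℕ) (hm : 0 < m) {π : (Fin (qOf m) × Fin (qOf m)) → τ}
    (hπ : Function.Injective π) (T : Finset (Fin 3 → Fin (qOf m)))
    (hinj : Set.InjOn (fun c => (leadExpR m π c).support.max) T) :
    AlgebraicIndependent ℂ (fun c : T => kiPer m (c : Fin 3 → Fin (qOf m))) := by
  classical
  have hne : ∀ c : T, (leadExpR m π (c : Fin 3 → Fin (qOf m))).support.Nonempty :=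
    fun c => support_leadExpR_nonempty m hm hπ c
  refine kiPer_algebraicIndependent_of_bottomInjective m hπ T (fun c => (leadExpR m π c.1).support.max' (hne c))
    (fun c => Finset.max'_mem _ _) (fun c x hx => Finset.le_max' _ x hx) ?_
  intro c c' h
  have h' : (leadExpR m π c.1).support.max' (hne c) = (leadExpR m π c'.1).support.max' (hne c') := h
  apply Subtype.ext
  apply hinj c.2 c'.2
  show (leadExpR m π c.1).support.max = (leadExpR m π c'.1).support.max
  rw [← Finset.coe_max' (hne c), ← Finset.coe_max' (hne c'), h']

/-! ## 3. Hitting consequence -/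

open Literature.Computability.AlgebraicComplexity Literature.Computability.MetaComplexity in
/-- **Bottom certificates of girth `g` ⟹ every nonzero `D` with `2·complexity D + 1 ≤ g` is hit.** If every `T` with
`|T| ≤ g` admits an injective ranking of the seed cells (into any well-ordered-above linear order, here `ℕᵒᵈ` via
`OrderDual.toDual ∘ h`) whose greedy-diagonal bottom cells are pairwise distinct on `T`, then the planted generator
hits every nonzero `D` of complexity `< g/2` (via `DefinabilityGapSymmetry.kiPer_hits_size_of_indep`). [this file] -/
theorem kiPer_hits_size_of_bottomCertificate (m g : ℕ) (hm : 0 < m)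
    (hcert : ∀ T : Finset (Fin 3 → Fin (qOf m)), T.card ≤ g →
      ∃ h : (Fin (qOf m) × Fin (qOf m)) → ℕ, Function.Injective h ∧
        Set.InjOn (fun c => (leadExpR m (OrderDual.toDual ∘ h) c).support.max) T)
    (D : MvPolynomial (Fin 3 → Fin (qOf m)) ℂ) (hD : D ≠ 0) (hsize : 2 * complexity D + 1 ≤ g) :
    bind₁ (kiPer m) D ≠ 0 := by
  refine DefinabilityGapSymmetry.kiPer_hits_size_of_indep m g (fun T hT => ?_) hD hsize
  obtain ⟨h, hh, hinj⟩ := hcert T hT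
  exact kiPer_algebraicIndependent_of_maxInjOn m hm (OrderDual.toDual.injective.comp hh) T hinj

end Summit.ValiantsHypothesis.ValiantsHypothesis.Theorems.DefinabilityGapBottomCertificate

end
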